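import Mathlib.Combinatorics.SimpleGraph.AdjMatrix
import Literature.Computability.QuantumComplexity.GluedTreesThm9View

/-!
# The parity colouring of ChildsEtAl2003 App. B: adjacency lists + a side bit = a consistent edge colouring

Helper for the support item `WbwSuccinctWalk` (stmt-QuantumAdvantage-2360) of route
`Summits/QuantumAdvantage/QuantumAdvantage/Theses/WhiteBoxWalk` (clause (Q) of `WbwThesis` for the
glued-trees witness, CIRCUIT-input model: the neighbour circuit returns sorted adjacency lists and no
edge colouring). Childs–Cleve–Deotto–Farhi–Gutmann–Spielman, arXiv:quant-ph/0209131, App. B: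
"the neighbors of a vertex must be given in some order, and this provides a coloring of the directed
edges. For a bipartite graph, this can be used to construct a consistent coloring of the undirected
graph. […] For vertices with parity 0, the color of each adjacent undirected edge is (incoming color,
outgoing color), and for vertices with parity 1, the color of each adjacent undirected edge is
(outgoing color, incoming color)."  The walk Hamiltonian is then simulated colour by colour
(§3.2: `H = Σ_c V_c T V_c`, each `v_c` an involution on its domain).

This file is the graph-theoretic content of that paragraph, for an arbitrary simple graph `G` with a
side function `side : V → Bool` separating the endpoints of every edge and local indices
`idx v : V → ℕ` injective on the neighbourhood of `v`:
* `ColourAdj G side idx i j` — the colour-`(i, j)` sub-relation; it is symmetric (`ColourAdj.symm`),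
  CONSISTENT = every vertex has at most one partner per colour (`ColourAdj.partner_unique`), every
  edge carries exactly one colour (`colourAdj_iff`, `adj_iff_exists_colourAdj`), and the adjacency
  matrix is the sum of the `d²` colour matrices when all local indices are `< d`
  (`adjMatrix_eq_sum_colourMatrix`);
* specialisation to the tree's glued trees `GluedTrees.graph n σ` with an arbitrary injective naming
  `ν` by `N`-bit strings and ANY side function `side : Vertex n → Bool` (the intended one is
  `parity` of the companion file `WhiteBoxWalkWbwSuccinctWalkBipartite`, whose `parity_ne_of_adj`
  discharges the hypothesis `hside` of the symmetry statement): `idx :=` the position of `ν w` in the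
  sorted neighbour-name list `gluedTreesOracle σ ν (ν v)` (`nbrIdx`), which is what two evaluations
  of a neighbour circuit compute (`colourAdj_iff_oracle`); for `1 ≤ n` all indices are `< 3`, so
  `hamiltonian n σ = (1/√2) • Σ_{i,j<3} colourMatrix …` (`hamiltonian_eq_sum_colourMatrix`): the walk
  Hamiltonian is `1/√2` times a sum of NINE `0/1` matrices with at most one `1` per row, symmetric
  as soon as `side` separates the endpoints of every edge.
[cite: ChildsEtAl2003, App. B and §3.2 (arXiv:quant-ph/0209131)]
-/

namespace Summit.QuantumAdvantage.QuantumAdvantage.Theorems.WbwSuccinctWalk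

/-! ## Generic part: a side bit and local indices give a consistent colouring -/

section Generic

variable {V : Type*} (G : SimpleGraph V) (side : V → Bool) (idx : V → V → ℕ)

/-- The colour-`(i, j)` edges of App. B: `{v, w} ∈ E` has colour `(i, j)` iff, read from its side-`0`
endpoint `v`, `w` is the `i`-th neighbour of `v` and `v` is the `j`-th neighbour of `w`.
[cite: ChildsEtAl2003, App. B] -/
def ColourAdj (i j : ℕ) : V → V → Prop := fun v w =>
  G.Adj v w ∧ ((side v = false ∧ idx v w = i ∧ idx w v = j) ∨ (side v = true ∧ idx w v = i ∧ idx v w = j))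

/-- `ColourAdj` is decidable when adjacency is. [folklore] -/
instance [DecidableRel G.Adj] (i j : ℕ) : DecidableRel (ColourAdj G side idx i j) := fun v w => by
  unfold ColourAdj; infer_instance

/-- The colour of the edge `{v, w}` as read at `v` (App. B: "(incoming colour, outgoing colour)" at
parity `0`, "(outgoing colour, incoming colour)" at parity `1`). [cite: ChildsEtAl2003, App. B] -/
def colourAt (v w : V) : ℕ × ℕ :=
  if side v then (idx w v, idx v w) else (idx v w, idx w v)

/-- The colour-`(i, j)` piece of the adjacency matrix (`1` on colour-`(i, j)` edges, `0` elsewhere).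
[cite: ChildsEtAl2003, §3.2 and App. B] -/
def colourMatrix [DecidableRel G.Adj] (R : Type*) [Zero R] [One R] (i j : ℕ) : Matrix V V R :=
  Matrix.of fun v w => if ColourAdj G side idx i j v w then 1 else 0

variable {G side idx} {i j i' j' : ℕ} {u v w w' : V}

/-- Coloured edges are edges. [folklore] -/
theorem ColourAdj.adj (h : ColourAdj G side idx i j v w) : G.Adj v w := h.1

/-- Every edge carries the colour read at either endpoint. [cite: ChildsEtAl2003, App. B] -/
theorem colourAdj_colourAt (h : G.Adj v w) :
    ColourAdj G side idx (colourAt side idx v w).1 (colourAt side idx v w).2 v w := by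
  refine ⟨h, ?_⟩
  unfold colourAt
  cases hv : side v <;> simp

/-- … and only that colour. [cite: ChildsEtAl2003, App. B] -/
theorem ColourAdj.eq_colourAt (h : ColourAdj G side idx i j v w) : (i, j) = colourAt side idx v w := by
  obtain ⟨-, hc⟩ := h
  unfold colourAt
  rcases hc with ⟨hv, rfl, rfl⟩ | ⟨hv, rfl, rfl⟩ <;> simp [hv]

/-- Characterisation: colour `(i, j)` at `(v, w)` iff `{v, w}` is an edge whose colour read at `v` is
`(i, j)`. [cite: ChildsEtAl2003, App. B] -/
theorem colourAdj_iff : ColourAdj G side idx i j v w ↔ G.Adj v w ∧ (i, j) = colourAt side idx v w := by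
  refine ⟨fun h => ⟨h.adj, h.eq_colourAt⟩, fun ⟨h, he⟩ => ?_⟩
  rw [Prod.ext_iff] at he
  obtain ⟨h1, h2⟩ := he
  dsimp only at h1 h2
  subst h1
  subst h2
  exact colourAdj_colourAt h

/-- The colour classes cover the edge set. [cite: ChildsEtAl2003, App. B] -/
theorem adj_iff_exists_colourAdj : G.Adj v w ↔ ∃ i j, ColourAdj G side idx i j v w :=
  ⟨fun h => ⟨_, _, colourAdj_colourAt h⟩, fun ⟨_, _, h⟩ => h.adj⟩

/-- An edge has only one colour (at a given endpoint). [cite: ChildsEtAl2003, App. B] -/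
theorem ColourAdj.colour_unique (h : ColourAdj G side idx i j v w) (h' : ColourAdj G side idx i' j' v w) :
    i = i' ∧ j = j' := by
  have := h.eq_colourAt.trans h'.eq_colourAt.symm
  simpa using this

/-- **Both endpoints read the same colour** (this is where bipartiteness enters: the side bit flips
along every edge, so the pair is swapped back). [cite: ChildsEtAl2003, App. B] -/
theorem ColourAdj.symm (hside : ∀ ⦃v w : V⦄, G.Adj v w → side v ≠ side w)
    (h : ColourAdj G side idx i j v w) : ColourAdj G side idx i j w v := by
  obtain ⟨hadj, hc⟩ := h
  have hs := hside hadj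
  refine ⟨hadj.symm, ?_⟩
  rcases hc with ⟨hv, h1, h2⟩ | ⟨hv, h1, h2⟩
  · refine Or.inr ⟨?_, h1, h2⟩
    cases hw : side w <;> simp_all
  · refine Or.inl ⟨?_, h1, h2⟩
    cases hw : side w <;> simp_all

/-- Symmetric form of `ColourAdj.symm`. [cite: ChildsEtAl2003, App. B] -/
theorem colourAdj_comm (hside : ∀ ⦃v w : V⦄, G.Adj v w → side v ≠ side w) :
    ColourAdj G side idx i j v w ↔ ColourAdj G side idx i j w v :=
  ⟨ColourAdj.symm hside, ColourAdj.symm hside⟩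

/-- **Consistency**: a vertex has at most one partner of each colour (local indices injective on
neighbourhoods). This is `v_c(v_c(a)) = a` / "no vertex is incident with two edges of the same
color" of §3.2. [cite: ChildsEtAl2003, §3.2 and App. B] -/
theorem ColourAdj.partner_unique (hidx : ∀ v : V, Set.InjOn (idx v) (G.neighborSet v))
    (h : ColourAdj G side idx i j v w) (h' : ColourAdj G side idx i j v w') : w = w' := by
  obtain ⟨hadj, hc⟩ := h
  obtain ⟨hadj', hc'⟩ := h'
  rcases hc with ⟨hv, h1, h2⟩ | ⟨hv, h1, h2⟩ <;> rcases hc' with ⟨hv', h1', h2'⟩ | ⟨hv', h1', h2'⟩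
  · exact hidx v hadj hadj' (h1.trans h1'.symm)
  · rw [hv] at hv'
    exact absurd hv' Bool.false_ne_true
  · rw [hv'] at hv
    exact absurd hv Bool.false_ne_true
  · exact hidx v hadj hadj' (h2.trans h2'.symm)

section Matrices

variable [DecidableRel G.Adj] {R : Type*}

/-- Entries of a colour matrix. [folklore] -/
@[simp] theorem colourMatrix_apply [Zero R] [One R] (i j : ℕ) (v w : V) :
    colourMatrix G side idx R i j v w = if ColourAdj G side idx i j v w then 1 else 0 := rfl

/-- Colour matrices are symmetric. [cite: ChildsEtAl2003, §3.2] -/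
theorem colourMatrix_isSymm [Zero R] [One R] (hside : ∀ ⦃v w : V⦄, G.Adj v w → side v ≠ side w)
    (i j : ℕ) : (colourMatrix G side idx R i j).IsSymm := by
  ext v w
  simp only [Matrix.transpose_apply, colourMatrix_apply, colourAdj_comm hside (v := w) (w := v)]

/-- Colour matrices are `1`-sparse: at most one nonzero entry in each row (finite vertex type).
[cite: ChildsEtAl2003, §3.2] -/
theorem card_filter_colourAdj_le_one [Fintype V] [DecidableEq V]
    (hidx : ∀ v : V, Set.InjOn (idx v) (G.neighborSet v)) (i j : ℕ) (v : V) :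
    (Finset.univ.filter fun w => ColourAdj G side idx i j v w).card ≤ 1 :=
  Finset.card_le_one.2 fun _ hw _ hw' =>
    (Finset.mem_filter.1 hw).2.partner_unique hidx (Finset.mem_filter.1 hw').2

/-- **The adjacency matrix is the sum of the `d²` colour matrices** when all local indices on edges
are `< d` (App. B with §3.2's `H = Σ_c V_c T V_c`). [cite: ChildsEtAl2003, §3.2 and App. B] -/
theorem adjMatrix_eq_sum_colourMatrix [DecidableEq V] [NonAssocSemiring R] {d : ℕ}
    (hbd : ∀ ⦃v w : V⦄, G.Adj v w → idx v w < d) :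
    G.adjMatrix R = ∑ i ∈ Finset.range d, ∑ j ∈ Finset.range d, colourMatrix G side idx R i j := by
  ext v w
  simp only [SimpleGraph.adjMatrix_apply, Matrix.sum_apply, colourMatrix_apply]
  by_cases h : G.Adj v w
  · rw [if_pos h]
    have hc1 : (colourAt side idx v w).1 < d := by
      unfold colourAt; split_ifs
      · exact hbd h.symm
      · exact hbd h
    have hc2 : (colourAt side idx v w).2 < d := by
      unfold colourAt; split_ifs
      · exact hbd h
      · exact hbd h.symm
    rw [Finset.sum_eq_single_of_mem _ (Finset.mem_range.2 hc1)]
    · rw [Finset.sum_eq_single_of_mem _ (Finset.mem_range.2 hc2)]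
      · rw [if_pos (colourAdj_colourAt h)]
      · intro j' _ hne
        rw [if_neg]
        intro hc
        exact hne (hc.colour_unique (colourAdj_colourAt h)).2
    · intro i' _ hne
      refine Finset.sum_eq_zero fun j' _ => ?_
      rw [if_neg]
      intro hc
      exact hne (hc.colour_unique (colourAdj_colourAt h)).1
  · rw [if_neg h]
    symm
    refine Finset.sum_eq_zero fun i' _ => Finset.sum_eq_zero fun j' _ => ?_
    rw [if_neg]
    exact fun hc => h hc.adj

end Matrices

end Generic

/-! ## The glued trees: local index = position in the sorted neighbour-name list (any side function) -/

section GluedTrees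

open Literature.Computability.QuantumComplexity GluedTrees

variable {n N : ℕ} (side : Vertex n → Bool)

/-- The local index of App. B for a named instance `(σ, ν)`: the position of the name of `w` in the
sorted neighbour-name list returned at the name of `v` (`gluedTreesOracle`, increasing binary value).
[cite: ChildsEtAl2003, App. B] -/
def nbrIdx (σ : CycleDatum n) (ν : Vertex n ↪ (Fin N → Bool)) (v w : Vertex n) : ℕ :=
  (gluedTreesOracle σ ν (ν v)).idxOf (ν w)

/-- The neighbour-name set at the name of a vertex, for names of any length `N`.
[cite: ChildsEtAl2003, §2] -/
theorem nbrNames_apply_emb (σ : CycleDatum n) (ν : Vertex n ↪ (Fin N → Bool)) (v : Vertex n) :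
    nbrNames σ ν (ν v) = ((graph n σ).neighborFinset v).map ν := by
  unfold nbrNames
  have : (Finset.univ.filter fun w ↦ ν w = ν v) = {v} := by
    ext w; simp [ν.injective.eq_iff]
  rw [this, Finset.singleton_biUnion]

/-- Membership in the oracle answer at the name of a vertex: exactly the names of its neighbours.
[cite: ChildsEtAl2003, §2] -/
theorem mem_gluedTreesOracle_iff (σ : CycleDatum n) (ν : Vertex n ↪ (Fin N → Bool)) (v : Vertex n)
    (a : Fin N → Bool) : a ∈ gluedTreesOracle σ ν (ν v) ↔ ∃ w, (graph n σ).Adj v w ∧ ν w = a := by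
  unfold gluedTreesOracle
  simp only [List.mem_map, Finset.mem_sort, Finset.mem_image, nbrNames_apply_emb, Finset.mem_map,
    SimpleGraph.mem_neighborFinset]
  constructor
  · rintro ⟨m, ⟨b, ⟨w, hw, rfl⟩, rfl⟩, rfl⟩
    exact ⟨w, hw, (nameOfVal_nameVal _).symm⟩
  · rintro ⟨w, hw, rfl⟩
    exact ⟨nameVal (ν w), ⟨ν w, ⟨w, hw, rfl⟩, rfl⟩, nameOfVal_nameVal _⟩

/-- The name of `w` is listed at the name of `v` iff `v — w`. [cite: ChildsEtAl2003, §2] -/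
theorem apply_mem_gluedTreesOracle_iff (σ : CycleDatum n) (ν : Vertex n ↪ (Fin N → Bool))
    (v w : Vertex n) : ν w ∈ gluedTreesOracle σ ν (ν v) ↔ (graph n σ).Adj v w := by
  rw [mem_gluedTreesOracle_iff]
  constructor
  · rintro ⟨w', hw', he⟩
    rwa [← ν.injective he]
  · exact fun h => ⟨w, h, rfl⟩

/-- Oracle answers have no repeated names. [cite: ChildsEtAl2003, §2] -/
theorem gluedTreesOracle_nodup (σ : CycleDatum n) (ν : Vertex n ↪ (Fin N → Bool)) (a : Fin N → Bool) :
    (gluedTreesOracle σ ν a).Nodup := by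
  unfold gluedTreesOracle
  refine List.Nodup.map_on ?_ (Finset.sort_nodup _ _)
  intro x hx y hy hxy
  rw [Finset.mem_sort, Finset.mem_image] at hx hy
  obtain ⟨b, -, rfl⟩ := hx
  obtain ⟨c, -, rfl⟩ := hy
  rw [nameOfVal_nameVal, nameOfVal_nameVal] at hxy
  rw [hxy]

/-- The answer at the name of a vertex lists `deg v` names. [cite: ChildsEtAl2003, §2] -/
theorem length_gluedTreesOracle (σ : CycleDatum n) (ν : Vertex n ↪ (Fin N → Bool)) (v : Vertex n) :
    (gluedTreesOracle σ ν (ν v)).length = (graph n σ).degree v := by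
  unfold gluedTreesOracle
  rw [List.length_map, Finset.length_sort, Finset.card_image_of_injective _ nameVal_injective,
    nbrNames_apply_emb, Finset.card_map, SimpleGraph.card_neighborFinset_eq_degree]

/-- Local indices are injective on neighbourhoods. [cite: ChildsEtAl2003, App. B] -/
theorem nbrIdx_injOn (σ : CycleDatum n) (ν : Vertex n ↪ (Fin N → Bool)) (v : Vertex n) :
    Set.InjOn (nbrIdx σ ν v) ((graph n σ).neighborSet v) := by
  intro w hw w' _ h
  exact ν.injective ((List.idxOf_inj ((apply_mem_gluedTreesOracle_iff σ ν v w).2 hw)).1 h)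

/-- The local index of a neighbour is below the degree. [cite: ChildsEtAl2003, App. B] -/
theorem nbrIdx_lt_degree (σ : CycleDatum n) (ν : Vertex n ↪ (Fin N → Bool)) {v w : Vertex n}
    (h : (graph n σ).Adj v w) : nbrIdx σ ν v w < (graph n σ).degree v := by
  rw [← length_gluedTreesOracle σ ν v]
  exact List.idxOf_lt_length_iff.2 ((apply_mem_gluedTreesOracle_iff σ ν v w).2 h)

/-- For `1 ≤ n` every local index on an edge is `< 3` (degrees are `2` or `3`, `GluedTrees.degree_eq`).
[cite: ChildsEtAl2003, §2] -/
theorem nbrIdx_lt_three (hn : 1 ≤ n) (σ : CycleDatum n) (ν : Vertex n ↪ (Fin N → Bool))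
    ⦃v w : Vertex n⦄ (h : (graph n σ).Adj v w) : nbrIdx σ ν v w < 3 := by
  refine (nbrIdx_lt_degree σ ν h).trans_le ?_
  rw [degree_eq hn]
  split_ifs <;> norm_num

/-- **The oracle form of the colouring**: colour `(i, j)` at `(v, w)` is decided by the two oracle
answers at the names of `v` and `w` and the side bit of `v` — `name w` is entry `i` (resp. `j`) of
the list at `name v` and `name v` is entry `j` (resp. `i`) of the list at `name w`. This is what a
walker holding `(name v, side v)` computes with two evaluations of the neighbour circuit.
[cite: ChildsEtAl2003, App. B] -/
theorem colourAdj_iff_oracle (σ : CycleDatum n) (ν : Vertex n ↪ (Fin N → Bool)) (i j : ℕ)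
    (v w : Vertex n) :
    ColourAdj (graph n σ) side (nbrIdx σ ν) i j v w ↔
      (side v = false ∧ (gluedTreesOracle σ ν (ν v))[i]? = some (ν w) ∧
          (gluedTreesOracle σ ν (ν w))[j]? = some (ν v)) ∨
      (side v = true ∧ (gluedTreesOracle σ ν (ν v))[j]? = some (ν w) ∧
          (gluedTreesOracle σ ν (ν w))[i]? = some (ν v)) := by
  -- `l[k]? = some a ↔ a ∈ l ∧ l.idxOf a = k` for the duplicate-free oracle answers
  have key : ∀ (x y : Vertex n) (k : ℕ),
      (gluedTreesOracle σ ν (ν x))[k]? = some (ν y) ↔ (graph n σ).Adj x y ∧ nbrIdx σ ν x y = k := by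
    intro x y k
    constructor
    · intro h
      have hk : k < (gluedTreesOracle σ ν (ν x)).length := by
        by_contra hk
        rw [List.getElem?_eq_none_iff.2 (not_lt.1 hk)] at h
        cases h
      have hget : (gluedTreesOracle σ ν (ν x))[k] = ν y := by
        rw [List.getElem?_eq_getElem hk] at h
        exact Option.some.inj h
      have hmem : ν y ∈ gluedTreesOracle σ ν (ν x) := by rw [← hget]; exact List.getElem_mem hk
      refine ⟨(apply_mem_gluedTreesOracle_iff σ ν x y).1 hmem, ?_⟩
      unfold nbrIdx
      have hlt : (gluedTreesOracle σ ν (ν x)).idxOf (ν y) < (gluedTreesOracle σ ν (ν x)).length :=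
        List.idxOf_lt_length_iff.2 hmem
      refine ((gluedTreesOracle_nodup σ ν (ν x)).getElem_inj_iff (hi := hlt) (hj := hk)).1 ?_
      rw [List.getElem_idxOf, hget]
    · rintro ⟨hadj, rfl⟩
      exact List.getElem?_idxOf ((apply_mem_gluedTreesOracle_iff σ ν x y).2 hadj)
  simp only [key]
  unfold ColourAdj
  constructor
  · rintro ⟨hadj, ⟨hp, h1, h2⟩ | ⟨hp, h1, h2⟩⟩
    · exact Or.inl ⟨hp, ⟨hadj, h1⟩, hadj.symm, h2⟩
    · exact Or.inr ⟨hp, ⟨hadj, h2⟩, hadj.symm, h1⟩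
  · rintro (⟨hp, ⟨hadj, h1⟩, -, h2⟩ | ⟨hp, ⟨hadj, h1⟩, -, h2⟩)
    · exact ⟨hadj, Or.inl ⟨hp, h1, h2⟩⟩
    · exact ⟨hadj, Or.inr ⟨hp, h2, h1⟩⟩

/-- **App. B for the glued trees**: for `1 ≤ n`, the adjacency matrix of `G'_n(σ)` is the sum of the
NINE colour matrices of the named instance `(σ, ν)` (any side function; the intended one is the
parity of `WhiteBoxWalkWbwSuccinctWalkBipartite`). [cite: ChildsEtAl2003, App. B] -/
theorem adjMatrix_graph_eq_sum_colourMatrix (hn : 1 ≤ n) (σ : CycleDatum n)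
    (ν : Vertex n ↪ (Fin N → Bool)) (R : Type*) [NonAssocSemiring R] :
    (graph n σ).adjMatrix R =
      ∑ i ∈ Finset.range 3, ∑ j ∈ Finset.range 3, colourMatrix (graph n σ) side (nbrIdx σ ν) R i j :=
  adjMatrix_eq_sum_colourMatrix (nbrIdx_lt_three hn σ ν)

/-- **The walk Hamiltonian, colour by colour**: `H = (1/√2) • Σ_{i,j<3} colourMatrix (i, j)` — nine
`1`-sparse (`card_filter_colourAdj_graph_le_one`) `0/1` matrices, each computable from two
neighbour-list evaluations (`colourAdj_iff_oracle`), symmetric when `side` separates the endpoints of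
every edge (`colourMatrix_graph_isSymm`). [cite: ChildsEtAl2003, §3.1, §3.2 and App. B] -/
theorem hamiltonian_eq_sum_colourMatrix (hn : 1 ≤ n) (σ : CycleDatum n)
    (ν : Vertex n ↪ (Fin N → Bool)) :
    hamiltonian n σ = ((Real.sqrt 2)⁻¹ : ℂ) •
      ∑ i ∈ Finset.range 3, ∑ j ∈ Finset.range 3, colourMatrix (graph n σ) side (nbrIdx σ ν) ℂ i j := by
  rw [hamiltonian, adjMatrix_graph_eq_sum_colourMatrix side hn σ ν ℂ]

/-- The nine colour matrices of a glued-trees instance are symmetric when the side bit separates the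
endpoints of every edge (for `side := parity` this is `parity_ne_of_adj` of
`WhiteBoxWalkWbwSuccinctWalkBipartite`) … [cite: ChildsEtAl2003, §3.2] -/
theorem colourMatrix_graph_isSymm (σ : CycleDatum n) (ν : Vertex n ↪ (Fin N → Bool)) (R : Type*)
    [Zero R] [One R] (hside : ∀ ⦃u v : Vertex n⦄, (graph n σ).Adj u v → side u ≠ side v) (i j : ℕ) :
    (colourMatrix (graph n σ) side (nbrIdx σ ν) R i j).IsSymm :=
  colourMatrix_isSymm hside i j

/-- … and `1`-sparse. [cite: ChildsEtAl2003, §3.2] -/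
theorem card_filter_colourAdj_graph_le_one (σ : CycleDatum n) (ν : Vertex n ↪ (Fin N → Bool))
    (i j : ℕ) (v : Vertex n) :
    (Finset.univ.filter fun w => ColourAdj (graph n σ) side (nbrIdx σ ν) i j v w).card ≤ 1 :=
  card_filter_colourAdj_le_one (nbrIdx_injOn σ ν) i j v

end GluedTrees

end Summit.QuantumAdvantage.QuantumAdvantage.Theorems.WbwSuccinctWalk
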